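/-
Copyright: the b2b-balaban T⁴-continuum CRUX team, row NE7b, leaf prover `t4-ne7b-formalise-leaf-01` (gen 78), for the
OWNER lineage `t4-ne7b-p1` and the refuter desk (PRICING-NE7b ρ-ne7bref-g63-2: the KERNEL-CONDITIONAL carrier). Project licence.
-/
import Summits.QuantumFields.BalabanUV.T4Continuum.Spine.NE7b.GaussianRankLocalMomentShift

/-!
# THE KERNEL-CONDITIONAL CARRIER OF A GAUSSIAN FLUCTUATION STEP: `LocCondStability`'s inequality for an event on the
# FINE field, β-free under an operator-form domination of the coarse field's share (model; two fields)

Cell `pub-balaban`, sub-cell `t4`, spine estimate NE7b (`T4WeightBudget.RelWeightBound` — NOT PRINTED, NOT PROVED).  Crux-route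
MODEL work under `Spine/NE7b/`; no `T4Continuum/Support` leaf; no `Prop` minted; nothing of [B15]∕[B16] named; no `[cite:]`; 0 `sorry`.

WHY.  For the 𝐑𝐓 step the pinned event lives on the step's FRESH variables, so `PointwiseExtraction` holds by definition of the
KERNEL-CONDITIONAL carrier `M(y) = ∫ 𝟙⁺ e^{δQ} k(y, dz)` and all the content sits in `LocCondStability` for that `M` (refuter
ρ-ne7bref-g63-2; `LocalConditionalStability.PointwiseExtraction`'s docstring).  THIS FILE computes the Gaussian model of that
situation with TWO fields: a coarse field `y : κ → ℝ` with density `e^{−yᵀA_c y}` and a fluctuation `z : ι → ℝ` with kernel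
density `e^{−zᵀA_f z}` (unnormalised; its mass `∫ e^{−zᵀA_f z}` is displayed and cancels in the row's relative currency); the
fine field is `z + P y` (`P` the interpolation) and the sacrificed part of the action on the region is `δ·(z + Py)ᵀB(z + Py)`,
`B ≤ A_f`.  RESULT (`fluct_carrier_integral_le`): for `ε > 0` with `δ(1+ε) < 1`, `δ(1+ε⁻¹) < 1` and the DOMINATION
`PᵀBP ≤ A_c` (the coarse field's share of the region's fine action is dominated by the coarse action — an operator-form
small-field ∕ regularity condition), `∫ M(y) e^{−yᵀA_c y} dy ≤ (√(1−δ(1+ε)))⁻¹ ^ rank B · (√(1−δ(1+ε⁻¹)))⁻¹ ^ rank (PᵀBP) ·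
(∫ e^{−zᵀA_f z} dz) · ∫ e^{−yᵀA_c y} dy` — the exponent `b` is `O(rank B)` (note `rank (PᵀBP) ≤ rank B`), β-FREE and
volume-free: `GaussianRankLocalMomentShift.integral_exp_qf_shift_le` in `z` (exterior `m = −Py`) followed by
`GaussianRankLocalMoment.integral_exp_qf_le` in `y`.

WHAT IS PROVED ([folklore]): `qf_conj_rect` (rectangular conjugation `(Pw)ᵀM(Pw) = wᵀ(PᵀMP)w`), `fluct_carrier_le` (the carrier
pointwise: `M(y) ≤ (√(1−δ(1+ε)))⁻¹ ^ rank B · e^{δ(1+ε⁻¹)·yᵀ(PᵀBP)y} · ∫ e^{−zᵀA_f z}`), **`fluct_carrier_integral_le`**; §3 (the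
chair leaf-04 g142's SUPPLY S-leaf04-g142-1, adapted): `fluct_carrier_stronglyMeasurable`, `fluct_carrier_mul_integrable` and the
PAIR **`fluct_model_locCondStability`** (integrability ∧ inequality — both conjuncts `LocCondStability` asks per pinned step; the
OWNER's `CarrierOnSupport.locCondStability_of_carrier_le_on_support` is the junction that asks the bound on the term's support only).

NOT HERE (honest).  Nothing about Bałaban's densities, small-field characteristic functions, normalisation constants (F353's
`log g⁻²` letter), the gauge-fixed Poincaré mechanism (F346), or the (A1c) instance; no `Tower` is built here (see
`GaussianRankLocalMomentTower` for the one-step multiplication tower).  BY-NAME EFFECT ON THE WALL: NONE.  NE7b NOT PRINTED ∕ NOT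
PROVED; spine PROVED 0∕9; rung (B)+1 on a FINITE torus — NOT infinite volume, NOT the mass gap, NOT Clay.
HONEST DEPENDENCY: continuum YM on T⁴ ⇐ BetaPertH ∧ nine spine estimates (0/9 proved); BetaPertH ⇐ (D1) ∧ (D4) ∧ CAP+tail;
G-an2-4 gates asym, D1 and NE2/3/4.
-/

set_option autoImplicit false

open MeasureTheory Real Matrix Finset
open Summit.QuantumFields.BalabanUV.T4Continuum.NE7b.GaussianRankLocalMoment
open Summit.QuantumFields.BalabanUV.T4Continuum.NE7b.GaussianRankLocalMomentShift

namespace Summit.QuantumFields.BalabanUV.T4Continuum.NE7b.GaussianRankLocalMomentFluct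

variable {ι κ : Type} [Fintype ι] [Fintype κ] [DecidableEq ι] [DecidableEq κ]

omit [DecidableEq ι] [DecidableEq κ] in
/-- Rectangular conjugation: `(P w)ᵀ M (P w) = wᵀ (Pᵀ M P) w` for `P : ι × κ`. [folklore] -/
theorem qf_conj_rect (M : Matrix ι ι ℝ) (P : Matrix ι κ ℝ) (w : κ → ℝ) :
    (P *ᵥ w) ⬝ᵥ (M *ᵥ (P *ᵥ w)) = w ⬝ᵥ ((Pᵀ * M * P) *ᵥ w) := by
  rw [mulVec_mulVec, dotProduct_mulVec, ← vecMul_transpose, vecMul_vecMul, ← dotProduct_mulVec, Matrix.mul_assoc]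

omit [DecidableEq κ] in
/-- **THE KERNEL-CONDITIONAL CARRIER, POINTWISE IN THE COARSE FIELD**: with exterior `m = −Py` in the shift theorem,
`M(y) = ∫ e^{δ (z+Py)ᵀB(z+Py)} e^{−zᵀA_f z} dz ≤ e^{δ(1+ε⁻¹)·yᵀ(PᵀBP)y} · (√(1−δ(1+ε)))⁻¹ ^ rank B · ∫ e^{−zᵀA_f z} dz`. [folklore] -/
theorem fluct_carrier_le {Af B : Matrix ι ι ℝ} (hAf : Af.PosDef) (hB : B.PosSemidef) (hAfB : (Af - B).PosSemidef)
    (P : Matrix ι κ ℝ) (y : κ → ℝ) {δ ε : ℝ} (hδ0 : 0 ≤ δ) (hε : 0 < ε) (hδε : δ * (1 + ε) < 1) :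
    ∫ z : ι → ℝ, exp (δ * ((z + P *ᵥ y) ⬝ᵥ (B *ᵥ (z + P *ᵥ y)))) * exp (-(z ⬝ᵥ (Af *ᵥ z))) ≤
      exp (δ * (1 + ε⁻¹) * (y ⬝ᵥ ((Pᵀ * B * P) *ᵥ y))) * ((√(1 - δ * (1 + ε)))⁻¹ ^ B.rank *
        ∫ z : ι → ℝ, exp (-(z ⬝ᵥ (Af *ᵥ z)))) := by
  have h := integral_exp_qf_shift_le hAf hB hAfB (-(P *ᵥ y)) hδ0 hε hδε
  have e1 : (-(P *ᵥ y)) ⬝ᵥ (B *ᵥ (-(P *ᵥ y))) = y ⬝ᵥ ((Pᵀ * B * P) *ᵥ y) := by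
    rw [mulVec_neg, dotProduct_neg, neg_dotProduct, neg_neg, qf_conj_rect]
  simp_rw [sub_neg_eq_add] at h
  rwa [e1] at h

/-- **`LocCondStability`'s INEQUALITY FOR THE FLUCTUATION STEP, β-FREE.**  Coarse density `e^{−yᵀA_c y}` (`A_c` positive
definite), kernel density `e^{−zᵀA_f z}` (`A_f` positive definite), sacrificed part `δ·(z+Py)ᵀB(z+Py)` with `0 ≤ B ≤ A_f`, and the
DOMINATION `PᵀBP ≤ A_c`; for `ε > 0` with `δ(1+ε) < 1`, `δ(1+ε⁻¹) < 1`: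
`∫ M(y) e^{−yᵀA_c y} dy ≤ (√(1−δ(1+ε)))⁻¹ ^ rank B · (√(1−δ(1+ε⁻¹)))⁻¹ ^ rank (PᵀBP) · (∫ e^{−zᵀA_f z} dz) · ∫ e^{−yᵀA_c y} dy`
— the carrier's conditional expectation in the coarse term's own state costs `e^{b}` with `b = O(rank B)` (times the kernel's
displayed mass), uniform in `|ι|`, `|κ|` and in both precisions. [folklore] -/
theorem fluct_carrier_integral_le {Af B : Matrix ι ι ℝ} {Ac : Matrix κ κ ℝ} (hAf : Af.PosDef) (hB : B.PosSemidef)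
    (hAfB : (Af - B).PosSemidef) (hAc : Ac.PosDef) (P : Matrix ι κ ℝ) (hAcP : (Ac - Pᵀ * B * P).PosSemidef)
    {δ ε : ℝ} (hδ0 : 0 ≤ δ) (hε : 0 < ε) (hδε : δ * (1 + ε) < 1) (hδε' : δ * (1 + ε⁻¹) < 1) :
    ∫ y : κ → ℝ, (∫ z : ι → ℝ, exp (δ * ((z + P *ᵥ y) ⬝ᵥ (B *ᵥ (z + P *ᵥ y)))) * exp (-(z ⬝ᵥ (Af *ᵥ z)))) *
        exp (-(y ⬝ᵥ (Ac *ᵥ y))) ≤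
      (√(1 - δ * (1 + ε)))⁻¹ ^ B.rank * (√(1 - δ * (1 + ε⁻¹)))⁻¹ ^ (Pᵀ * B * P).rank *
        (∫ z : ι → ℝ, exp (-(z ⬝ᵥ (Af *ᵥ z)))) * ∫ y : κ → ℝ, exp (-(y ⬝ᵥ (Ac *ᵥ y))) := by
  set K₁ : ℝ := (√(1 - δ * (1 + ε)))⁻¹ ^ B.rank * ∫ z : ι → ℝ, exp (-(z ⬝ᵥ (Af *ᵥ z))) with hK₁
  have hK₁0 : 0 ≤ K₁ :=
    mul_nonneg (pow_nonneg (inv_nonneg.2 (Real.sqrt_nonneg _)) _) (integral_nonneg fun z => (exp_pos _).le)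
  have hδ'0 : 0 ≤ δ * (1 + ε⁻¹) := by positivity
  have hPBP : (Pᵀ * B * P).PosSemidef := by
    simpa only [conjTranspose_eq_transpose_of_trivial] using hB.conjTranspose_mul_mul_same P
  -- pointwise in `y` (the shift theorem in `z`), then the centred theorem in `y` at fraction `δ(1+ε⁻¹)` with `PᵀBP ≤ A_c`
  have hpt : ∀ y : κ → ℝ,
      (∫ z : ι → ℝ, exp (δ * ((z + P *ᵥ y) ⬝ᵥ (B *ᵥ (z + P *ᵥ y)))) * exp (-(z ⬝ᵥ (Af *ᵥ z)))) *
          exp (-(y ⬝ᵥ (Ac *ᵥ y))) ≤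
        K₁ * (exp (δ * (1 + ε⁻¹) * (y ⬝ᵥ ((Pᵀ * B * P) *ᵥ y))) * exp (-(y ⬝ᵥ (Ac *ᵥ y)))) := fun y => by
    have := mul_le_mul_of_nonneg_right (fluct_carrier_le hAf hB hAfB P y hδ0 hε hδε) (exp_pos (-(y ⬝ᵥ (Ac *ᵥ y)))).le
    calc _ ≤ _ := this
      _ = _ := by rw [hK₁]; ring
  calc ∫ y : κ → ℝ, (∫ z : ι → ℝ, exp (δ * ((z + P *ᵥ y) ⬝ᵥ (B *ᵥ (z + P *ᵥ y)))) * exp (-(z ⬝ᵥ (Af *ᵥ z)))) *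
          exp (-(y ⬝ᵥ (Ac *ᵥ y)))
      ≤ ∫ y : κ → ℝ, K₁ * (exp (δ * (1 + ε⁻¹) * (y ⬝ᵥ ((Pᵀ * B * P) *ᵥ y))) * exp (-(y ⬝ᵥ (Ac *ᵥ y)))) :=
        integral_mono_of_nonneg
          (Filter.Eventually.of_forall fun y => mul_nonneg (integral_nonneg fun z => by positivity) (exp_pos _).le)
          ((integrable_exp_qf hAc hPBP hAcP hδ'0 hδε').const_mul K₁) (Filter.Eventually.of_forall hpt)
    _ = K₁ * ∫ y : κ → ℝ, exp (δ * (1 + ε⁻¹) * (y ⬝ᵥ ((Pᵀ * B * P) *ᵥ y))) * exp (-(y ⬝ᵥ (Ac *ᵥ y))) :=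
        integral_const_mul _ _
    _ ≤ K₁ * ((√(1 - δ * (1 + ε⁻¹)))⁻¹ ^ (Pᵀ * B * P).rank * ∫ y : κ → ℝ, exp (-(y ⬝ᵥ (Ac *ᵥ y)))) :=
        mul_le_mul_of_nonneg_left (integral_exp_qf_le hAc hPBP hAcP hδ'0 hδε') hK₁0
    _ = _ := by rw [hK₁]; ring

/-! ## §3 The `Integrable` conjunct and the `LocCondStability`-shaped pair (SUPPLY S-leaf04-g142-1 of the chair leaf-04 g142,
journal l.52002, kernel-checked there against v1; adapted to v2's `integrable_exp_qf` binder — credited, [folklore]) -/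

omit [DecidableEq ι] [DecidableEq κ] in
/-- **THE KERNEL-CONDITIONAL CARRIER IS STRONGLY MEASURABLE IN THE COARSE FIELD**: `y ↦ M(y) = ∫ e^{δ(z+Py)ᵀB(z+Py)}
e^{−zᵀA_f z} dz` is the Bochner integral of a continuous two-field integrand along the fluctuation variable
(`MeasureTheory.StronglyMeasurable.integral_prod_right` — the measurability half of Fubini). [folklore] -/
theorem fluct_carrier_stronglyMeasurable (Af B : Matrix ι ι ℝ) (P : Matrix ι κ ℝ) (δ : ℝ) :
    StronglyMeasurable (fun y : κ → ℝ =>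
      ∫ z : ι → ℝ, exp (δ * ((z + P *ᵥ y) ⬝ᵥ (B *ᵥ (z + P *ᵥ y)))) * exp (-(z ⬝ᵥ (Af *ᵥ z)))) := by
  have hc : Continuous (Function.uncurry fun (y : κ → ℝ) (z : ι → ℝ) =>
      exp (δ * ((z + P *ᵥ y) ⬝ᵥ (B *ᵥ (z + P *ᵥ y)))) * exp (-(z ⬝ᵥ (Af *ᵥ z)))) := by
    unfold Function.uncurry
    fun_prop
  exact hc.stronglyMeasurable.integral_prod_right

/-- **THE `Integrable` CONJUNCT OF `LocCondStability` FOR THE FLUCTUATION STEP.**  Under the hypotheses of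
`fluct_carrier_integral_le`, `y ↦ M(y)·e^{−yᵀA_c y}` is integrable: strongly measurable by
`fluct_carrier_stronglyMeasurable`, and dominated pointwise (`fluct_carrier_le`) by
`K₁ · e^{δ(1+ε⁻¹)·yᵀ(PᵀBP)y} · e^{−yᵀA_c y}`, integrable by `GaussianRankLocalMoment.integrable_exp_qf` at fraction
`δ(1+ε⁻¹) < 1` under `PᵀBP ≤ A_c`. [folklore] -/
theorem fluct_carrier_mul_integrable {Af B : Matrix ι ι ℝ} {Ac : Matrix κ κ ℝ} (hAf : Af.PosDef) (hB : B.PosSemidef)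
    (hAfB : (Af - B).PosSemidef) (hAc : Ac.PosDef) (P : Matrix ι κ ℝ) (hAcP : (Ac - Pᵀ * B * P).PosSemidef)
    {δ ε : ℝ} (hδ0 : 0 ≤ δ) (hε : 0 < ε) (hδε : δ * (1 + ε) < 1) (hδε' : δ * (1 + ε⁻¹) < 1) :
    Integrable (fun y : κ → ℝ =>
      (∫ z : ι → ℝ, exp (δ * ((z + P *ᵥ y) ⬝ᵥ (B *ᵥ (z + P *ᵥ y)))) * exp (-(z ⬝ᵥ (Af *ᵥ z)))) *
        exp (-(y ⬝ᵥ (Ac *ᵥ y)))) := by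
  set K₁ : ℝ := (√(1 - δ * (1 + ε)))⁻¹ ^ B.rank * ∫ z : ι → ℝ, exp (-(z ⬝ᵥ (Af *ᵥ z))) with hK₁
  have hδ'0 : 0 ≤ δ * (1 + ε⁻¹) := by positivity
  have hPBP : (Pᵀ * B * P).PosSemidef := by
    simpa only [conjTranspose_eq_transpose_of_trivial] using hB.conjTranspose_mul_mul_same P
  refine ((integrable_exp_qf hAc hPBP hAcP hδ'0 hδε').const_mul K₁).mono' ?_ (Filter.Eventually.of_forall fun y => ?_)
  · exact ((fluct_carrier_stronglyMeasurable Af B P δ).mul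
      (by fun_prop : Continuous fun y : κ → ℝ => exp (-(y ⬝ᵥ (Ac *ᵥ y)))).stronglyMeasurable).aestronglyMeasurable
  · rw [Real.norm_eq_abs, abs_of_nonneg (mul_nonneg (integral_nonneg fun z => by positivity) (exp_pos _).le)]
    calc (∫ z : ι → ℝ, exp (δ * ((z + P *ᵥ y) ⬝ᵥ (B *ᵥ (z + P *ᵥ y)))) * exp (-(z ⬝ᵥ (Af *ᵥ z)))) *
          exp (-(y ⬝ᵥ (Ac *ᵥ y)))
        ≤ exp (δ * (1 + ε⁻¹) * (y ⬝ᵥ ((Pᵀ * B * P) *ᵥ y))) * ((√(1 - δ * (1 + ε)))⁻¹ ^ B.rank *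
            ∫ z : ι → ℝ, exp (-(z ⬝ᵥ (Af *ᵥ z)))) * exp (-(y ⬝ᵥ (Ac *ᵥ y))) :=
          mul_le_mul_of_nonneg_right (fluct_carrier_le hAf hB hAfB P y hδ0 hε hδε) (exp_pos _).le
      _ = K₁ * (exp (δ * (1 + ε⁻¹) * (y ⬝ᵥ ((Pᵀ * B * P) *ᵥ y))) * exp (-(y ⬝ᵥ (Ac *ᵥ y)))) := by
          rw [hK₁]; ring

/-- **IN `LocCondStability`'s SHAPE, FOR THE FLUCTUATION STEP: BOTH CONJUNCTS** — integrability of `M·e` and the inequality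
`∫ M·e ≤ e^{b}·(kernel mass)·∫ e` of `fluct_carrier_integral_le`, packaged as the pair the named `Prop` asks per pinned step.
[folklore] -/
theorem fluct_model_locCondStability {Af B : Matrix ι ι ℝ} {Ac : Matrix κ κ ℝ} (hAf : Af.PosDef) (hB : B.PosSemidef)
    (hAfB : (Af - B).PosSemidef) (hAc : Ac.PosDef) (P : Matrix ι κ ℝ) (hAcP : (Ac - Pᵀ * B * P).PosSemidef)
    {δ ε : ℝ} (hδ0 : 0 ≤ δ) (hε : 0 < ε) (hδε : δ * (1 + ε) < 1) (hδε' : δ * (1 + ε⁻¹) < 1) :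
    Integrable (fun y : κ → ℝ =>
      (∫ z : ι → ℝ, exp (δ * ((z + P *ᵥ y) ⬝ᵥ (B *ᵥ (z + P *ᵥ y)))) * exp (-(z ⬝ᵥ (Af *ᵥ z)))) *
        exp (-(y ⬝ᵥ (Ac *ᵥ y)))) ∧
    ∫ y : κ → ℝ, (∫ z : ι → ℝ, exp (δ * ((z + P *ᵥ y) ⬝ᵥ (B *ᵥ (z + P *ᵥ y)))) * exp (-(z ⬝ᵥ (Af *ᵥ z)))) *
        exp (-(y ⬝ᵥ (Ac *ᵥ y))) ≤
      (√(1 - δ * (1 + ε)))⁻¹ ^ B.rank * (√(1 - δ * (1 + ε⁻¹)))⁻¹ ^ (Pᵀ * B * P).rank *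
        (∫ z : ι → ℝ, exp (-(z ⬝ᵥ (Af *ᵥ z)))) * ∫ y : κ → ℝ, exp (-(y ⬝ᵥ (Ac *ᵥ y))) :=
  ⟨fluct_carrier_mul_integrable hAf hB hAfB hAc P hAcP hδ0 hε hδε hδε',
    fluct_carrier_integral_le hAf hB hAfB hAc P hAcP hδ0 hε hδε hδε'⟩

end Summit.QuantumFields.BalabanUV.T4Continuum.NE7b.GaussianRankLocalMomentFluct
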